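import Literature.NumberTheory.Sieve.AsymptoticSieveForPrimesRough
import Literature.NumberTheory.Sieve.AsymptoticSieveForPrimesReduction
import Literature.NumberTheory.Sieve.SieveFrameworkProofs
import HarnessLib

/-!
# Asymptotic sieve for primes under (B*): smooth and rough parts, the `j`-regrouping, the `τ⁶` moment and Rankin's trick (tools for §10)

Topic `Literature/NumberTheory/Sieve` (trunk T-SIEVE), a sequel of
`Literature.NumberTheory.Sieve.AsymptoticSieveForPrimesRough`. Source: J. Friedlander, H. Iwaniec,
*Asymptotic sieve for primes*, Ann. of Math. 148 (1998) 1041–1065 [FriedlanderIwaniecASP1998]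
(= arXiv:math/9811186), §10 pp. 1064–1065 (proof of Theorem 3): "We write `n = n₀n₁` where
`(n₀, Π) = 1` and `n₁ ∣ Π`. The contribution to (B̃) from terms with `n₁ > Δ` is estimated trivially
as `W₁` … by Rankin's trick. We choose `ε = (log P)⁻¹` … (10.4) `W₁ ≪ A(x)(log x)^{-2^{33}}`. Next we
estimate the contribution of terms with `n₁ ≤ Δ` … In the case (10.3) we have
`γ(n₀n₁; t) = ∑_{d₁ ∣ n₁} μ(d₁) γ(n₀; t/d₁)`. Insert this and change variables `t → td₁`,
`w → wn₁`"; and §2 Lemma 1 (p. 1047) with (1.6) for divisor moments of `a_n`.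

This file provides the elementary tools of that argument, for the sequel that re-derives (8.5)
under (B*) (`fi_asp_S3_estimate_rough`, where the bilinear forms of (8.1) carry the discrete weights
`λ⁻(c) = ∑_{j<C₀} log((j+1)/j) γ(c; j)`):

* `sum_Icc_eq_sum_sqfree_smooth_sum_rough` — the decomposition `n = n₁ n₀` as an identity of finite sums:
  for `f` supported on squarefree integers and a real sieving parameter `P`,
  `∑_{c ≤ B} f(c) = ∑_{n₁ ≤ B, n₁ squarefree, p ∣ n₁ ⇒ p < P} ∑_{n₀ ≤ B/n₁, p ∣ n₀ ⇒ p ≥ P} f(n₁n₀)`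
  (the map `(n₁, n₀) ↦ n₁n₀` is injective, and every squarefree `c` is `n₁n₀` with `n₁`, `n₀` the
  products of its prime factors `< P`, resp. `≥ P`);
* `fiGamma_mul_of_coprime_support` — `γ(n₀n₁; t) = ∑_{d₁ ∣ n₁} μ(d₁) γ(n₀; t/d₁)` for coprime
  `n₀, n₁` (FI (10.3) display);
* `sum_Ico_log_mul_apply_div_le` — the discrete form of the change of variables `t → t d₁` against
  `dt/t`: for `d ≥ 1` and `F ≥ 0` with `F(0) = 0`,
  `∑_{1≤j<C₀} log((j+1)/j) F(⌊j/d⌋) ≤ ∑_{1≤q<C₀} log((q+1)/q) F(q)` (the `j` with `⌊j/d⌋ = q` lie in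
  `[qd, (q+1)d)` and their weights telescope to at most `log((q+1)/q)`);
* `FIAsymptoticSieveHypotheses.sum_a_mul_card_divisors_pow_six_le` — the divisor moment
  `∑_{n≤x} a_n τ(n)⁶ ≤ 2^{18} K₆ e^{2^{28}} A(x)(log x)^{2^{26}}` (Lemma 1 with `k = 3` and (1.6), as
  the tree's `…pow_four_le`), with the general-exponent sum
  `∑_{d ≤ N sqfree} τ(d)^j/d ≤ exp(2^j (log log N + 4))` (`sum_squarefree_card_divisors_pow_div_le'`);
* Rankin's trick for the smooth variable: `rpow_inv_log_le_exp_card_primeFactors`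
  (`n₁^{1/log P} ≤ e^{ω(n₁)}` for squarefree `n₁` with all prime factors `< P`) and
  `indicator_lt_le_rankin` (`1 ≤ L^{-ε} n₁^{ε}` for `n₁ > L`).

## References

* J. Friedlander, H. Iwaniec, *Asymptotic sieve for primes*, Ann. of Math. 148 (1998), 1041–1065,
  §10 pp. 1064–1065 and §2 Lemma 1. [cite: FriedlanderIwaniecASP1998, §10 (10.3)-(10.4) and §2 Lemma 1]

## Mathlib / tree search

Mathlib: `Nat.prod_primeFactors_of_squarefree`, `Finset.prod_filter_mul_prod_filter_not`,
`Nat.Coprime.sum_divisors_mul` (used through an explicit product of divisor sets here),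
`Finset.sum_Ico_sub` (telescoping), `Nat.div_eq_iff`/`Nat.lt_div_iff_mul_lt`, `Finset.sum_image`,
`Finset.sum_subset`, `Finset.sum_fiberwise_of_maps_to`, `Nat.primeFactors_prod`; `Nat.smoothNumbers` exists but is keyed on a
natural bound and carries no "rough" companion in the needed form (`(p : ℝ) ≥ P`, the convention of
`fiBilinearRough`). Tree: `Squarefree.exists_dvd_pow_le_card_divisors_le` (FI Lemma 1,
`SmallDivisorLemma`), `sum_squarefree_prod_primeFactors_le`, `prod_one_add_le_exp_sum`,
`card_divisors_of_squarefree`, `SieveSequence.sum_mul_congrSum_eq` (`…Reduction`),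
`LFunctions.MertensBound.sum_inv_prime_le`, `fiGamma` (`…AsymptoticSieveForPrimes`).
`lean search 'smooth_sum_rough|pow_six_le|rankin'` in the ASP series: nothing before this file.
-/

noncomputable section

open Filter Finset
open scoped ArithmeticFunction.Moebius ArithmeticFunction.sigma ArithmeticFunction.omega

namespace Literature.NumberTheory.Sieve

/-! ### Smooth and rough parts of a squarefree integer -/

section SmoothRough

variable (P : ℝ)

/-- For squarefree `c`, `c = (∏_{p ∣ c, p < P} p) · (∏_{p ∣ c, p ≥ P} p)`. [folklore] -/
theorem smooth_mul_rough_eq {c : ℕ} (hc : Squarefree c) :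
    (∏ p ∈ c.primeFactors.filter (fun p : ℕ => (p : ℝ) < P), p) *
      (∏ p ∈ c.primeFactors.filter (fun p : ℕ => ¬ (p : ℝ) < P), p) = c := by
  rw [Finset.prod_filter_mul_prod_filter_not, Nat.prod_primeFactors_of_squarefree hc]

/-- Uniqueness of the smooth part: if `n₁ n₀ = n₁' n₀'` with `n₁, n₁'` squarefree and `P`-smooth and
`n₀, n₀'` `P`-rough, then `n₁ = n₁'`. [folklore] -/
theorem smooth_eq_of_mul_eq {n₁ n₀ n₁' n₀' : ℕ} (h1 : Squarefree n₁) (h1' : Squarefree n₁')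
    (hs : ∀ p ∈ n₁.primeFactors, (p : ℝ) < P) (hs' : ∀ p ∈ n₁'.primeFactors, (p : ℝ) < P)
    (hr : ∀ p ∈ n₀.primeFactors, P ≤ (p : ℝ)) (hr' : ∀ p ∈ n₀'.primeFactors, P ≤ (p : ℝ))
    (hn₀ : n₀ ≠ 0) (hn₀' : n₀' ≠ 0) (heq : n₁ * n₀ = n₁' * n₀') : n₁ = n₁' := by
  -- both are the product of the prime factors `< P` of the common product
  have key : ∀ {a b : ℕ}, Squarefree a → (∀ p ∈ a.primeFactors, (p : ℝ) < P) →
      (∀ p ∈ b.primeFactors, P ≤ (p : ℝ)) → b ≠ 0 →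
      a.primeFactors = (a * b).primeFactors.filter (fun p : ℕ => (p : ℝ) < P) := by
    intro a b ha hsa hrb hb
    ext p
    rw [Finset.mem_filter, Nat.primeFactors_mul ha.ne_zero hb, Finset.mem_union]
    constructor
    · intro hp
      exact ⟨Or.inl hp, hsa p hp⟩
    · rintro ⟨hp | hp, hlt⟩
      · exact hp
      · exact absurd hlt (not_lt.mpr (hrb p hp))
  have e1 := key h1 hs hr hn₀
  have e2 := key h1' hs' hr' hn₀'
  rw [heq] at e1
  rw [← Nat.prod_primeFactors_of_squarefree h1, ← Nat.prod_primeFactors_of_squarefree h1', e1, e2]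

/-- **The decomposition `n = n₁ n₀` (smooth × rough) as an identity of finite sums** (FI §10:
"We write `n = n₀n₁` where `(n₀, Π) = 1` and `n₁ ∣ Π`"): for `f` vanishing off the squarefree
integers and a real sieving parameter `P`,
`∑_{c ≤ B} f(c) = ∑_{n₁ ≤ B, n₁ squarefree, all prime factors < P} ∑_{n₀ ≤ B/n₁, all prime factors ≥ P} f(n₁ n₀)`.
[cite: FriedlanderIwaniecASP1998, §10 p. 1064] -/
theorem sum_Icc_eq_sum_sqfree_smooth_sum_rough {f : ℕ → ℝ} (hf : ∀ c, ¬Squarefree c → f c = 0) (B : ℕ) :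
    ∑ c ∈ Icc 1 B, f c =
      ∑ n₁ ∈ (Icc 1 B).filter (fun n : ℕ => Squarefree n ∧ ∀ p ∈ n.primeFactors, (p : ℝ) < P),
        ∑ n₀ ∈ (Icc 1 (B / n₁)).filter (fun n : ℕ => ∀ p ∈ n.primeFactors, P ≤ (p : ℝ)),
          f (n₁ * n₀) := by
  classical
  set S₁ := (Icc 1 B).filter (fun n : ℕ => Squarefree n ∧ ∀ p ∈ n.primeFactors, (p : ℝ) < P) with hS₁
  set R : ℕ → Finset ℕ := fun n₁ =>
    (Icc 1 (B / n₁)).filter (fun n : ℕ => ∀ p ∈ n.primeFactors, P ≤ (p : ℝ)) with hR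
  set T := S₁.sigma R with hT
  -- the right-hand side as a sum over the sigma set, then over its image under `(n₁, n₀) ↦ n₁ n₀`
  have hrhs : ∑ n₁ ∈ S₁, ∑ n₀ ∈ R n₁, f (n₁ * n₀) = ∑ q ∈ T, f (q.1 * q.2) :=
    (Finset.sum_sigma S₁ R (fun q => f (q.1 * q.2))).symm
  have hinj : Set.InjOn (fun q : (Σ _ : ℕ, ℕ) => q.1 * q.2) ↑T := by
    rintro ⟨n₁, n₀⟩ hq ⟨n₁', n₀'⟩ hq' (heq : n₁ * n₀ = n₁' * n₀')
    rw [Finset.mem_coe, hT, Finset.mem_sigma] at hq hq'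
    obtain ⟨h1, h0⟩ := hq
    obtain ⟨h1', h0'⟩ := hq'
    dsimp only at h1 h0 h1' h0'
    obtain ⟨h1I, hsq, hsm⟩ := Finset.mem_filter.mp h1
    obtain ⟨h1I', hsq', hsm'⟩ := Finset.mem_filter.mp h1'
    obtain ⟨h0I, hro⟩ := Finset.mem_filter.mp h0
    obtain ⟨h0I', hro'⟩ := Finset.mem_filter.mp h0'
    have hn₀ : n₀ ≠ 0 := Nat.one_le_iff_ne_zero.mp (Finset.mem_Icc.mp h0I).1
    have hn₀' : n₀' ≠ 0 := Nat.one_le_iff_ne_zero.mp (Finset.mem_Icc.mp h0I').1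
    have hn₁ : n₁ ≠ 0 := hsq.ne_zero
    have e1 : n₁ = n₁' := smooth_eq_of_mul_eq P hsq hsq' hsm hsm' hro hro' hn₀ hn₀' heq
    subst e1
    have e0 : n₀ = n₀' := Nat.eq_of_mul_eq_mul_left (Nat.pos_of_ne_zero hn₁) heq
    subst e0
    rfl
  have himage : ∑ q ∈ T, f (q.1 * q.2) = ∑ c ∈ T.image (fun q : (Σ _ : ℕ, ℕ) => q.1 * q.2), f c := by
    rw [Finset.sum_image hinj]
  show ∑ c ∈ Icc 1 B, f c = ∑ n₁ ∈ S₁, ∑ n₀ ∈ R n₁, f (n₁ * n₀)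
  rw [hrhs, himage]
  symm
  refine Finset.sum_subset (fun c hc => ?_) (fun c hc hnot => ?_)
  · -- the image lies in `[1, B]`
    obtain ⟨⟨n₁, n₀⟩, hq, rfl⟩ := Finset.mem_image.mp hc
    rw [hT, Finset.mem_sigma] at hq
    obtain ⟨h1, h0⟩ := hq
    obtain ⟨h1I, -, -⟩ := Finset.mem_filter.mp h1
    obtain ⟨h0I, -⟩ := Finset.mem_filter.mp h0
    obtain ⟨hn₁1, hn₁B⟩ := Finset.mem_Icc.mp h1I
    obtain ⟨hn₀1, hn₀B⟩ := Finset.mem_Icc.mp h0I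
    refine Finset.mem_Icc.mpr ⟨Nat.mul_pos hn₁1 hn₀1, ?_⟩
    have := (Nat.le_div_iff_mul_le hn₁1).mp hn₀B
    rw [mul_comm] at this
    exact this
  · -- off the image, `c` is not squarefree (a squarefree `c` is `n₁ n₀` with `(n₁, n₀) ∈ T`)
    refine hf c fun hsq => hnot ?_
    obtain ⟨hc1, hcB⟩ := Finset.mem_Icc.mp hc
    set n₁ := ∏ p ∈ c.primeFactors.filter (fun p : ℕ => (p : ℝ) < P), p with hn₁
    set n₀ := ∏ p ∈ c.primeFactors.filter (fun p : ℕ => ¬ (p : ℝ) < P), p with hn₀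
    have hprod : n₁ * n₀ = c := smooth_mul_rough_eq P hsq
    have hprime1 : ∀ q ∈ c.primeFactors.filter (fun p : ℕ => (p : ℝ) < P), q.Prime :=
      fun q hq => Nat.prime_of_mem_primeFactors (Finset.mem_filter.mp hq).1
    have hprime0 : ∀ q ∈ c.primeFactors.filter (fun p : ℕ => ¬ (p : ℝ) < P), q.Prime :=
      fun q hq => Nat.prime_of_mem_primeFactors (Finset.mem_filter.mp hq).1
    have hpf1 : n₁.primeFactors = c.primeFactors.filter (fun p : ℕ => (p : ℝ) < P) :=
      Nat.primeFactors_prod hprime1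
    have hpf0 : n₀.primeFactors = c.primeFactors.filter (fun p : ℕ => ¬ (p : ℝ) < P) :=
      Nat.primeFactors_prod hprime0
    have hn₁dvd : n₁ ∣ c := ⟨n₀, hprod.symm⟩
    have hn₀dvd : n₀ ∣ c := ⟨n₁, by rw [mul_comm]; exact hprod.symm⟩
    have hn₁0 : n₁ ≠ 0 := ne_zero_of_dvd_ne_zero hsq.ne_zero hn₁dvd
    have hn₀0 : n₀ ≠ 0 := ne_zero_of_dvd_ne_zero hsq.ne_zero hn₀dvd
    have hc0 : 0 < c := hc1
    refine Finset.mem_image.mpr ⟨⟨n₁, n₀⟩, ?_, hprod⟩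
    rw [hT, Finset.mem_sigma]
    refine ⟨Finset.mem_filter.mpr ⟨Finset.mem_Icc.mpr ⟨Nat.pos_of_ne_zero hn₁0,
      (Nat.le_of_dvd hc0 hn₁dvd).trans hcB⟩, hsq.squarefree_of_dvd hn₁dvd, fun p hp => ?_⟩,
      Finset.mem_filter.mpr ⟨Finset.mem_Icc.mpr ⟨Nat.pos_of_ne_zero hn₀0, ?_⟩, fun p hp => ?_⟩⟩
    · rw [hpf1] at hp
      exact (Finset.mem_filter.mp hp).2
    · rw [Nat.le_div_iff_mul_le (Nat.pos_of_ne_zero hn₁0), mul_comm, hprod]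
      exact hcB
    · rw [hpf0] at hp
      exact not_lt.mp (Finset.mem_filter.mp hp).2

end SmoothRough

/-! ### `γ(n₀ n₁; t) = ∑_{d₁ ∣ n₁} μ(d₁) γ(n₀; t/d₁)` -/

/-- **FI (10.3) display, the multiplicative splitting of `γ`** (in `ℝ`): for coprime `n₀, n₁` and
real `t`, `γ(n₀n₁; t) = ∑_{d₁ ∣ n₁} μ(d₁) γ(n₀; t/d₁)` (the divisors of `n₀n₁` are the products
`d₀d₁` of divisors, `μ(d₀d₁) = μ(d₀)μ(d₁)`, and `d₀d₁ ≤ t ⇔ d₀ ≤ t/d₁`).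
[cite: FriedlanderIwaniecASP1998, §10 display after (10.5) heading "In the case (10.3)", p. 1065] -/
theorem fiGamma_mul_of_coprime {n₀ n₁ : ℕ} (hcop : Nat.Coprime n₀ n₁) (t : ℝ) :
    (SieveSequence.fiGamma t (n₀ * n₁) : ℝ) =
      ∑ d₁ ∈ n₁.divisors, (μ d₁ : ℝ) * (SieveSequence.fiGamma (t / d₁) n₀ : ℝ) := by
  classical
  have hL : (SieveSequence.fiGamma t (n₀ * n₁) : ℝ) =
      ∑ d ∈ (n₀ * n₁).divisors, (if (d : ℝ) ≤ t then (μ d : ℝ) else 0) := by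
    rw [SieveSequence.fiGamma, Int.cast_sum, Finset.sum_filter]
  rw [hL, sum_divisors_mul_of_coprime hcop, Finset.sum_comm]
  refine Finset.sum_congr rfl fun b hb => ?_
  have hb0 : (0 : ℝ) < b := by exact_mod_cast Nat.pos_of_mem_divisors hb
  rw [SieveSequence.fiGamma, Int.cast_sum, Finset.sum_filter, Finset.mul_sum]
  refine Finset.sum_congr rfl fun a ha => ?_
  have hab : Nat.Coprime a b :=
    Nat.Coprime.of_dvd (Nat.dvd_of_mem_divisors ha) (Nat.dvd_of_mem_divisors hb) hcop
  have hiff : ((a * b : ℕ) : ℝ) ≤ t ↔ (a : ℝ) ≤ t / b := by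
    rw [Nat.cast_mul, le_div_iff₀ hb0]
  by_cases h : (a : ℝ) ≤ t / b
  · rw [if_pos (hiff.mpr h), if_pos h, ArithmeticFunction.isMultiplicative_moebius.map_mul_of_coprime hab,
      Int.cast_mul, mul_comm]
  · rw [if_neg (fun h' => h (hiff.mp h')), if_neg h, mul_zero]

/-! ### The `j`-regrouping (discrete change of variables `t → t d₁` against `dt/t`) -/

/-- Telescoping: `∑_{a ≤ j < b} log((j+1)/j) = log b - log a` for `1 ≤ a ≤ b`. [folklore] -/
theorem sum_Ico_log_succ_div (a b : ℕ) (ha : 1 ≤ a) (hab : a ≤ b) :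
    ∑ j ∈ Ico a b, Real.log (((j : ℝ) + 1) / j) = Real.log b - Real.log a := by
  have h := Finset.sum_Ico_sub (f := fun j : ℕ => Real.log ((j : ℕ) : ℝ)) hab
  rw [← h]
  refine Finset.sum_congr rfl fun j hj => ?_
  have hj0 : (0 : ℝ) < j := by exact_mod_cast (show 0 < j from lt_of_lt_of_le ha (Finset.mem_Ico.mp hj).1)
  show Real.log (((j : ℝ) + 1) / j) = Real.log ((j + 1 : ℕ) : ℝ) - Real.log ((j : ℕ) : ℝ)
  rw [Real.log_div (by positivity) hj0.ne']
  push_cast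
  ring

/-- The weights `log((j+1)/j)` are nonnegative for `j ≥ 1`. [folklore] -/
theorem log_succ_div_nonneg {j : ℕ} (hj : 1 ≤ j) : 0 ≤ Real.log (((j : ℝ) + 1) / j) := by
  have hj1 : (1 : ℝ) ≤ j := by exact_mod_cast hj
  exact Real.log_nonneg (by rw [le_div_iff₀ (by linarith)]; linarith)

/-- **The `j`-regrouping** (discrete form of FI's change of variables `t → t d₁` in
`∫_1^C … γ(n₀; t/d₁) dt/t`, §10 p. 1065): for `d ≥ 1` and `F ≥ 0` with `F(0) = 0`,
`∑_{1 ≤ j < C₀} log((j+1)/j) F(⌊j/d⌋) ≤ ∑_{1 ≤ q < C₀} log((q+1)/q) F(q)`: the `j` with `⌊j/d⌋ = q ≥ 1`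
form a subinterval of `[qd, (q+1)d)`, whose weights telescope to at most `log((q+1)d/(qd)) =
log((q+1)/q)`, and `q ≤ j < C₀`; the `j` with `⌊j/d⌋ = 0` contribute nothing.
[cite: FriedlanderIwaniecASP1998, §10 p. 1065] -/
theorem sum_Ico_log_mul_apply_div_le {C₀ d : ℕ} (hd : 1 ≤ d) {F : ℕ → ℝ} (hF0 : ∀ q, 0 ≤ F q)
    (hF : F 0 = 0) :
    ∑ j ∈ Ico 1 C₀, Real.log (((j : ℝ) + 1) / j) * F (j / d) ≤
      ∑ q ∈ Ico 1 C₀, Real.log (((q : ℝ) + 1) / q) * F q := by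
  classical
  set w : ℕ → ℝ := fun j => Real.log (((j : ℝ) + 1) / j) with hw
  -- group the `j` according to `q = ⌊j/d⌋ ∈ [0, C₀)`
  have hmaps : ∀ j ∈ Ico 1 C₀, j / d ∈ range C₀ := fun j hj =>
    Finset.mem_range.mpr (lt_of_le_of_lt (Nat.div_le_self j d) (Finset.mem_Ico.mp hj).2)
  rw [← Finset.sum_fiberwise_of_maps_to hmaps]
  -- the right-hand side over `range C₀` (the term `q = 0` vanishes)
  have hR : ∑ q ∈ Ico 1 C₀, w q * F q = ∑ q ∈ range C₀, w q * F q := by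
    rcases Nat.eq_zero_or_pos C₀ with h0 | hpos
    · subst h0; simp
    · rw [Finset.range_eq_Ico, ← Finset.sum_Ico_consecutive _ (Nat.zero_le 1) hpos]
      simp [hF]
  rw [hR]
  refine Finset.sum_le_sum fun q hq => ?_
  -- inside the fiber, `F (j / d) = F q`
  have hfib : ∑ j ∈ (Ico 1 C₀).filter (fun j => j / d = q), w j * F (j / d) =
      (∑ j ∈ (Ico 1 C₀).filter (fun j => j / d = q), w j) * F q := by
    rw [Finset.sum_mul]
    refine Finset.sum_congr rfl fun j hj => ?_
    rw [(Finset.mem_filter.mp hj).2]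
  rw [hfib]
  rcases Nat.eq_zero_or_pos q with h0 | hq1
  · subst h0; rw [hF, mul_zero, mul_zero]
  refine mul_le_mul_of_nonneg_right ?_ (hF0 q)
  -- the fiber lies in `[qd, qd + d)` and the weights telescope
  have hsub : (Ico 1 C₀).filter (fun j => j / d = q) ⊆ Ico (q * d) (q * d + d) := by
    intro j hj
    obtain ⟨-, hjq⟩ := Finset.mem_filter.mp hj
    refine Finset.mem_Ico.mpr ⟨?_, ?_⟩
    · rw [← hjq]; exact Nat.div_mul_le_self j d
    · have h1 : j / d < q + 1 := by omega
      have h2 := (Nat.div_lt_iff_lt_mul hd).mp h1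
      linarith [h2]
  have hqd1 : 1 ≤ q * d := Nat.one_le_iff_ne_zero.mpr (Nat.mul_ne_zero (by omega) (by omega))
  calc ∑ j ∈ (Ico 1 C₀).filter (fun j => j / d = q), w j
      ≤ ∑ j ∈ Ico (q * d) (q * d + d), w j := by
        refine Finset.sum_le_sum_of_subset_of_nonneg hsub fun j hj _ => ?_
        exact log_succ_div_nonneg (le_trans hqd1 (Finset.mem_Ico.mp hj).1)
    _ = Real.log ((q * d + d : ℕ) : ℝ) - Real.log ((q * d : ℕ) : ℝ) :=
        sum_Ico_log_succ_div (q * d) (q * d + d) hqd1 (Nat.le_add_right _ _)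
    _ = w q := by
        have hq0 : (0 : ℝ) < q := by exact_mod_cast hq1
        have hd0 : (0 : ℝ) < d := by exact_mod_cast hd
        rw [hw]
        dsimp only
        rw [← Real.log_div (by positivity) (by positivity)]
        congr 1
        push_cast
        field_simp

/-! ### Rankin's trick on the smooth variable -/

/-- For a squarefree `n` all of whose prime factors are `< P` (`P > 1`),
`n^{1/log P} = ∏_{p ∣ n} p^{1/log P} ≤ e^{ω(n)}` (each factor is `≤ P^{1/log P} = e`; FI §10:
"We choose `ε = (log P)⁻¹` so that `p^ε < 8p^{-ε}`… for every `p ≤ P`").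
[cite: FriedlanderIwaniecASP1998, §10 p. 1064] -/
theorem rpow_inv_log_le_exp_card_primeFactors {P : ℝ} (hP : 1 < P) {n : ℕ} (hn : Squarefree n)
    (hs : ∀ p ∈ n.primeFactors, (p : ℝ) < P) :
    (n : ℝ) ^ (1 / Real.log P) ≤ Real.exp n.primeFactors.card := by
  have hlogP : 0 < Real.log P := Real.log_pos hP
  have hε : 0 ≤ 1 / Real.log P := by positivity
  conv_lhs => rw [← Nat.prod_primeFactors_of_squarefree hn]
  rw [Nat.cast_prod, ← Real.finsetProd_rpow _ _ (fun p _ => Nat.cast_nonneg p)]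
  calc ∏ p ∈ n.primeFactors, ((p : ℕ) : ℝ) ^ (1 / Real.log P)
      ≤ ∏ _p ∈ n.primeFactors, Real.exp 1 := by
        refine Finset.prod_le_prod (fun p _ => Real.rpow_nonneg (Nat.cast_nonneg _) _) fun p hp => ?_
        calc ((p : ℕ) : ℝ) ^ (1 / Real.log P) ≤ P ^ (1 / Real.log P) :=
              Real.rpow_le_rpow (Nat.cast_nonneg _) (hs p hp).le hε
          _ = Real.exp 1 := by
              rw [Real.rpow_def_of_pos (by linarith), show Real.log P * (1 / Real.log P) = 1 by
                field_simp]
    _ = Real.exp n.primeFactors.card := by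
        rw [Finset.prod_const, ← Real.exp_nat_mul, mul_one]

/-- Rankin's device: for `L > 0`, `ε ≥ 0` and `n > L`, `1 ≤ L^{-ε} n^{ε}`. [folklore] -/
theorem one_le_rpow_neg_mul_rpow {L ε n : ℝ} (hL : 0 < L) (hε : 0 ≤ ε) (hn : L < n) :
    1 ≤ L ^ (-ε) * n ^ ε := by
  have hn0 : 0 < n := hL.trans hn
  rw [Real.rpow_neg hL.le, ← div_eq_inv_mul, ← Real.div_rpow hn0.le hL.le]
  exact Real.one_le_rpow ((one_le_div hL).mpr hn.le) hε

/-- `e^{ω(n)} ≤ τ(n)²` for squarefree `n` (`τ(n) = 2^{ω(n)}`, `e ≤ 4`). [folklore] -/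
theorem exp_card_primeFactors_le_card_divisors_sq {n : ℕ} (hn : Squarefree n) :
    Real.exp n.primeFactors.card ≤ ((n.divisors.card : ℝ)) ^ 2 := by
  rw [card_divisors_of_squarefree hn]
  push_cast
  rw [← pow_mul, mul_comm, pow_mul, show ((2 : ℝ) ^ 2) = 4 by norm_num,
    ← mul_one (n.primeFactors.card : ℝ), Real.exp_nat_mul]
  refine pow_le_pow_left₀ (Real.exp_pos 1).le ?_ _
  have := Real.exp_one_lt_d9
  linarith

/-! ### The divisor moment `∑ a_n τ(n)⁶` (Lemma 1 and (1.6)) -/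

/-- For squarefree `d`, `τ(d)^j/d = ∏_{p ∣ d} 2^j/p`. [folklore] -/
theorem card_divisors_pow_div_eq_prod' (j : ℕ) {d : ℕ} (hd : Squarefree d) :
    ((d.divisors.card : ℝ) ^ j) / d = ∏ p ∈ d.primeFactors, (2 : ℝ) ^ j / p := by
  rw [card_divisors_of_squarefree hd, Finset.prod_div_distrib, Finset.prod_const,
    ← Nat.cast_prod, Nat.prod_primeFactors_of_squarefree hd]
  push_cast
  rw [← pow_mul, mul_comm, pow_mul]

/-- `∑_{d ≤ N, d squarefree} τ(d)^j/d ≤ exp(2^j (log log N + 4))` for `N ≥ 2` (the tree's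
`sum_squarefree_card_divisors_pow_div_le` is the case `j = 20`), by
`sum_squarefree_prod_primeFactors_le` and Mertens' bound `∑_{p ≤ N} 1/p ≤ log log N + 4`.
[cite: FriedlanderIwaniecASP1998, §2 (2.1)] -/
theorem sum_squarefree_card_divisors_pow_div_le' (j N : ℕ) (hN : 2 ≤ N) :
    ∑ d ∈ (Icc 1 N).filter Squarefree, ((d.divisors.card : ℝ) ^ j) / d ≤
      Real.exp (2 ^ j * (Real.log (Real.log N) + 4)) := by
  have h1 : ∑ d ∈ (Icc 1 N).filter Squarefree, ((d.divisors.card : ℝ) ^ j) / d =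
      ∑ d ∈ (Icc 1 N).filter Squarefree, ∏ p ∈ d.primeFactors, (2 : ℝ) ^ j / p :=
    Finset.sum_congr rfl fun d hd => card_divisors_pow_div_eq_prod' j (Finset.mem_filter.mp hd).2
  rw [h1]
  refine (sum_squarefree_prod_primeFactors_le (fun p _ => by positivity) N).trans ?_
  refine (prod_one_add_le_exp_sum _ fun p _ => by positivity).trans ?_
  refine Real.exp_le_exp.mpr ?_
  simp_rw [div_eq_mul_inv]
  rw [← Finset.mul_sum]
  refine mul_le_mul_of_nonneg_left ?_ (by positivity)
  have := LFunctions.MertensBound.sum_inv_prime_le N hN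
  simpa [one_div] using this

/-- FI Lemma 1 with `k = 3` for the sixth moment: for squarefree `n`,
`τ(n)⁶ ≤ ∑_{d ∣ n, d³ ≤ n} (2τ(d))^{18}`. [cite: FriedlanderIwaniecASP1998, §2 Lemma 1] -/
theorem card_divisors_pow_six_le_sum {n : ℕ} (hn : Squarefree n) :
    ((n.divisors.card : ℝ)) ^ 6 ≤
      ∑ d ∈ n.divisors.filter (fun d => d ^ 3 ≤ n), (2 * (d.divisors.card : ℝ)) ^ 18 := by
  obtain ⟨d, hdn, hd3, hτ⟩ := Squarefree.exists_dvd_pow_le_card_divisors_le (k := 3) (by norm_num) hn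
  have hd : d ∈ n.divisors.filter (fun d => d ^ 3 ≤ n) :=
    Finset.mem_filter.mpr ⟨Nat.mem_divisors.mpr ⟨hdn, hn.ne_zero⟩, hd3⟩
  refine le_trans ?_ (Finset.single_le_sum (fun e _ => by positivity) hd)
  have h' : ((n.divisors.card : ℝ)) ≤ (2 * (d.divisors.card : ℝ)) ^ 3 := by exact_mod_cast hτ
  calc ((n.divisors.card : ℝ)) ^ 6 ≤ ((2 * (d.divisors.card : ℝ)) ^ 3) ^ 6 :=
        pow_le_pow_left₀ (Nat.cast_nonneg _) h' 6
    _ = (2 * (d.divisors.card : ℝ)) ^ 18 := by rw [← pow_mul]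

variable {A : SieveSequence} {D δ Δ : ℝ → ℝ} in
/-- **The sixth divisor moment of `a_n`**: `∑_{n ≤ x} a_n τ(n)⁶ ≤ ∑_{d ≤ x^{1/3}, d sqfree} (2τ(d))^{18}
A_d(x) ≤ 2^{18} K₆ e^{2^{28}} A(x)(log x)^{2^{26}}` (FI Lemma 1 with `k = 3`, (1.6) and
`∑^♭_{d} τ(d)^{26}/d ≪ (log x)^{2^{26}}`), given (1.6) at `x ≥ 8` with constant `K₆`; the proof is the
tree's `sum_a_mul_card_divisors_pow_four_le` with the exponents changed. Used in §10 to bound the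
terms `W₁` (large smooth part) trivially. [cite: FriedlanderIwaniecASP1998, §2 (2.1) and §10 (10.4)] -/
theorem SieveSequence.FIAsymptoticSieveHypotheses.sum_a_mul_card_divisors_pow_six_le
    (h : A.FIAsymptoticSieveHypotheses D δ Δ) {K₆ x : ℝ} (hx : 8 ≤ x)
    (h16 : ∀ d : ℕ, 1 ≤ d → (d : ℝ) ≤ x ^ (1 / 3 : ℝ) →
      A.congrSum d x ≤ K₆ * (σ 0 d : ℝ) ^ 8 / d * A.size x) :
    ∑ n ∈ Ioc 0 ⌊x⌋₊, A.a n * ((n.divisors.card : ℝ)) ^ 6 ≤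
      2 ^ 18 * max K₆ 0 * Real.exp (2 ^ 28) * A.size x * Real.log x ^ (2 ^ 26 : ℝ) := by
  classical
  have hx1 : (1 : ℝ) < x := by linarith
  have hx0 : (0 : ℝ) ≤ x := by linarith
  have hlogx : 0 < Real.log x := Real.log_pos hx1
  have hA0 : 0 ≤ A.size x := by rw [h.size_eq]; exact A.congrSum_nonneg 1 x
  set N : ℕ := ⌊x ^ (1 / 3 : ℝ)⌋₊ with hN
  have hx13 : (2 : ℝ) ≤ x ^ (1 / 3 : ℝ) := by
    have h8 : (8 : ℝ) ^ (1 / 3 : ℝ) = 2 := by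
      rw [show (8 : ℝ) = 2 ^ 3 by norm_num, ← Real.rpow_natCast, ← Real.rpow_mul (by norm_num)]
      norm_num
    rw [← h8]
    exact Real.rpow_le_rpow (by norm_num) hx (by norm_num)
  have hN2 : 2 ≤ N := Nat.le_floor (by exact_mod_cast hx13)
  set S₃ := (Icc 1 N).filter Squarefree with hS₃
  -- Step 2
  have step2 : ∑ n ∈ Ioc 0 ⌊x⌋₊, A.a n * ((n.divisors.card : ℝ)) ^ 6 ≤
      ∑ d ∈ S₃, (2 * (d.divisors.card : ℝ)) ^ 18 * A.congrSum d x := by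
    rw [A.sum_mul_congrSum_eq]
    refine Finset.sum_le_sum fun n hn => ?_
    obtain ⟨hn0, hnx⟩ := Finset.mem_Ioc.mp hn
    by_cases hsq : Squarefree n
    · refine mul_le_mul_of_nonneg_left ((card_divisors_pow_six_le_sum hsq).trans ?_) (A.a_nonneg n)
      refine Finset.sum_le_sum_of_subset_of_nonneg (fun d hd => ?_) fun d _ _ => by positivity
      obtain ⟨hd1, hd3⟩ := Finset.mem_filter.mp hd
      have hdn : d ∣ n := Nat.dvd_of_mem_divisors hd1
      have hd0 : 0 < d := Nat.pos_of_mem_divisors hd1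
      refine Finset.mem_filter.mpr ⟨Finset.mem_filter.mpr ⟨Finset.mem_Icc.mpr ⟨hd0, ?_⟩,
        hsq.squarefree_of_dvd hdn⟩, hdn⟩
      refine Nat.le_floor ?_
      have hd3' : ((d : ℝ)) ^ 3 ≤ x := by
        have : ((d ^ 3 : ℕ) : ℝ) ≤ (n : ℝ) := by exact_mod_cast hd3
        push_cast at this
        exact this.trans ((Nat.cast_le.mpr hnx).trans (Nat.floor_le hx0))
      have hroot : (((d : ℝ)) ^ 3) ^ (1 / 3 : ℝ) = d := by
        rw [← Real.rpow_natCast, ← Real.rpow_mul (Nat.cast_nonneg _)]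
        norm_num
      calc (d : ℝ) = (((d : ℝ)) ^ 3) ^ (1 / 3 : ℝ) := hroot.symm
        _ ≤ x ^ (1 / 3 : ℝ) := Real.rpow_le_rpow (by positivity) hd3' (by norm_num)
    · rw [h.a_eq_zero hsq, zero_mul, zero_mul]
  -- Step 3: (1.6) on `S₃`
  have step3 : ∑ d ∈ S₃, (2 * (d.divisors.card : ℝ)) ^ 18 * A.congrSum d x ≤
      2 ^ 18 * max K₆ 0 * A.size x * ∑ d ∈ S₃, ((d.divisors.card : ℝ) ^ 26) / d := by
    rw [Finset.mul_sum]
    refine Finset.sum_le_sum fun d hd => ?_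
    obtain ⟨hd1, -⟩ := Finset.mem_filter.mp hd
    obtain ⟨hd1', hdN⟩ := Finset.mem_Icc.mp hd1
    have hdx : (d : ℝ) ≤ x ^ (1 / 3 : ℝ) :=
      (Nat.cast_le.mpr hdN).trans (Nat.floor_le (by positivity))
    have hd0 : (0 : ℝ) < d := by exact_mod_cast hd1'
    have h6 := h16 d hd1' hdx
    rw [ArithmeticFunction.sigma_zero_apply] at h6
    have h6' : A.congrSum d x ≤ max K₆ 0 * ((d.divisors.card : ℝ)) ^ 8 / d * A.size x := by
      refine h6.trans ?_
      gcongr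
      exact le_max_left _ _
    calc (2 * (d.divisors.card : ℝ)) ^ 18 * A.congrSum d x
        ≤ (2 * (d.divisors.card : ℝ)) ^ 18 * (max K₆ 0 * ((d.divisors.card : ℝ)) ^ 8 / d * A.size x) :=
          mul_le_mul_of_nonneg_left h6' (by positivity)
      _ = 2 ^ 18 * max K₆ 0 * A.size x * (((d.divisors.card : ℝ)) ^ 26 / d) := by
          rw [mul_pow]; ring
  -- Step 4
  have step4 : ∑ d ∈ S₃, ((d.divisors.card : ℝ) ^ 26) / d ≤
      Real.exp (2 ^ 28) * Real.log x ^ (2 ^ 26 : ℝ) := by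
    refine (sum_squarefree_card_divisors_pow_div_le' 26 N hN2).trans ?_
    have hN0 : (0 : ℝ) < N := by exact_mod_cast (by omega : 0 < N)
    have hNx : (N : ℝ) ≤ x := by
      refine (Nat.floor_le (by positivity)).trans ?_
      calc x ^ (1 / 3 : ℝ) ≤ x ^ (1 : ℝ) := Real.rpow_le_rpow_of_exponent_le hx1.le (by norm_num)
        _ = x := Real.rpow_one x
    have hlogN : 0 < Real.log N := Real.log_pos (by exact_mod_cast hN2)
    have hll : Real.log (Real.log N) ≤ Real.log (Real.log x) :=
      Real.log_le_log hlogN (Real.log_le_log hN0 hNx)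
    rw [Real.rpow_def_of_pos hlogx, ← Real.exp_add]
    refine Real.exp_le_exp.mpr ?_
    nlinarith
  calc ∑ n ∈ Ioc 0 ⌊x⌋₊, A.a n * ((n.divisors.card : ℝ)) ^ 6
      ≤ 2 ^ 18 * max K₆ 0 * A.size x * ∑ d ∈ S₃, ((d.divisors.card : ℝ) ^ 26) / d :=
        step2.trans step3
    _ ≤ 2 ^ 18 * max K₆ 0 * A.size x * (Real.exp (2 ^ 28) * Real.log x ^ (2 ^ 26 : ℝ)) :=
        mul_le_mul_of_nonneg_left step4 (by positivity)
    _ = 2 ^ 18 * max K₆ 0 * Real.exp (2 ^ 28) * A.size x * Real.log x ^ (2 ^ 26 : ℝ) := by ring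

end Literature.NumberTheory.Sieve
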